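import Mathlib
import HarnessLib
import Literature.MathematicalPhysics.QuantumManyBody.BoseEinsteinCondensation

/-!
# Crux `ParticleTensorisation` (stmt-AtomisticToContinuum-14367) — the AT clause is closed under
# `L²` limits of the amplitude

The division-free approximate-tensorisation clause of the crux
`Summit.AtomisticToContinuum.BoseEinsteinCondensation.Theses.BECHeatBathGap.ParticleTensorisation`,
`∀ F g (bounded measurable, gᵢ blind to xᵢ), ∃ c, ∫⁻ ‖F - cΘ‖₊² ≤ C Σᵢ ∫⁻ ‖F - gᵢΘ‖₊²`,
passes to `L²(μ)`-limits of the amplitude on a finite measure space: if it holds with the same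
constant `C` for every `Θₙ`, the `Θₙ` are measurable, `∫⁻ ‖Θₙ - Φ‖₊² → 0` and `0 < ∫⁻ ‖Φ‖₊² < ⊤`,
then it holds for `Φ` (`clause_of_tendsto`). Consequence used by every record of the crux
(`Cruxes/ParticleTensorisation/Lines/registered-dead*.md`): because the crux demands a witness at
EVERY absolute energy slack `δ > 0`, any `L²`-cluster point of witnesses as `δ → 0` — at fixed `N, L`
the Dirichlet ground state — inherits the clause with the same constant; so the existential typing
of the crux does not weaken it below an `N`-uniform heat-bath Poincaré inequality for `|Ψ₀|²`, and a
refutation may be run on `Ψ₀` directly. Proof: for fixed bounded `(F, g)` both sides are continuous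
in `Θ ∈ L²`; the coefficients `cₙ` are eventually bounded because `‖Φ‖₂ > 0`, so a convergent
subsequence exists (Bolzano–Weierstrass) and the inequality passes to the limit. Tools only
(`--supports`); nothing here touches the crux itself.
-/

noncomputable section

namespace Summit.AtomisticToContinuum.BoseEinsteinCondensation.Theorems.ATClause

open MeasureTheory Function Finset Set Filter
open scoped ENNReal Topology
open Literature.MathematicalPhysics.QuantumManyBody.BoseGas

variable {α : Type*} [MeasurableSpace α] {μ : Measure α}

/-- `(‖f‖_{L²})² = ∫⁻ ‖f‖₊²`. [folklore] -/
theorem eLpNorm_two_pow_two (f : α → ℂ) :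
    eLpNorm f 2 μ ^ 2 = ∫⁻ x, (‖f x‖₊ : ℝ≥0∞) ^ 2 ∂μ := by
  rw [eLpNorm_eq_lintegral_rpow_enorm_toReal (by norm_num) (by norm_num)]
  simp only [ENNReal.toReal_ofNat, ENNReal.rpow_ofNat, enorm_eq_nnnorm, one_div]
  rw [← ENNReal.rpow_two, ← ENNReal.rpow_mul]
  norm_num

/-- `‖f‖_{L²} = (∫⁻ ‖f‖₊²)^{1/2}`. [folklore] -/
theorem eLpNorm_two_eq_rpow (f : α → ℂ) :
    eLpNorm f 2 μ = (∫⁻ x, (‖f x‖₊ : ℝ≥0∞) ^ 2 ∂μ) ^ (1 / 2 : ℝ) := by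
  rw [← eLpNorm_two_pow_two, ← ENNReal.rpow_two, ← ENNReal.rpow_mul]
  norm_num

/-- If `∫⁻ ‖uₙ‖₊² → 0` then `‖uₙ‖_{L²} → 0`. [folklore] -/
theorem tendsto_eLpNorm_two_of_tendsto_lintegral {u : ℕ → α → ℂ}
    (h : Tendsto (fun n => ∫⁻ x, (‖u n x‖₊ : ℝ≥0∞) ^ 2 ∂μ) atTop (𝓝 0)) :
    Tendsto (fun n => eLpNorm (u n) 2 μ) atTop (𝓝 0) := by
  have hc : Tendsto (fun y : ℝ≥0∞ => y ^ (1 / 2 : ℝ)) (𝓝 0) (𝓝 0) := by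
    have := (ENNReal.continuous_rpow_const (y := (1 / 2 : ℝ))).tendsto 0
    rwa [ENNReal.zero_rpow_of_pos (by norm_num)] at this
  simpa only [eLpNorm_two_eq_rpow, Function.comp_def] using hc.comp h

/-- A bounded multiplier costs at most its bound in `L²`: `‖g·f‖₂ ≤ M ‖f‖₂`. [folklore] -/
theorem eLpNorm_mul_le_of_bound {g f : α → ℂ} {M : ℝ} (hg : ∀ x, ‖g x‖ ≤ M) :
    eLpNorm (fun x => g x * f x) 2 μ ≤ ENNReal.ofReal M * eLpNorm f 2 μ := by
  refine eLpNorm_le_mul_eLpNorm_of_ae_le_mul (Eventually.of_forall fun x => ?_) 2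
  rw [norm_mul]
  exact mul_le_mul_of_nonneg_right (hg x) (norm_nonneg _)

/-- `‖b‖₂ ≤ ‖a‖₂ + ‖a - b‖₂` (triangle inequality, the form used below). [folklore] -/
theorem eLpNorm_le_add_eLpNorm_sub {a b : α → ℂ} (ha : AEStronglyMeasurable a μ)
    (hb : AEStronglyMeasurable b μ) : eLpNorm b 2 μ ≤ eLpNorm a 2 μ + eLpNorm (a - b) 2 μ := by
  have := eLpNorm_add_le ha (hb.sub ha) (p := 2) (μ := μ) (by norm_num)
  rw [add_sub_cancel, eLpNorm_sub_comm] at this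
  exact this

/-- `‖a‖₂ ≤ ‖b‖₂ + ‖a - b‖₂` (triangle inequality, the other form used below). [folklore] -/
theorem eLpNorm_le_add_eLpNorm_sub' {a b : α → ℂ} (ha : AEStronglyMeasurable a μ)
    (hb : AEStronglyMeasurable b μ) : eLpNorm a 2 μ ≤ eLpNorm b 2 μ + eLpNorm (a - b) 2 μ := by
  have := eLpNorm_add_le hb (ha.sub hb) (p := 2) (μ := μ) (by norm_num)
  rwa [add_sub_cancel] at this

/-- Continuity of the `L²` norm along a sequence: `‖aₙ - b‖₂ → 0` and `‖b‖₂ < ⊤` give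
`‖aₙ‖₂ → ‖b‖₂`. [folklore] -/
theorem tendsto_eLpNorm_of_tendsto_sub {a : ℕ → α → ℂ} {b : α → ℂ}
    (ha : ∀ n, AEStronglyMeasurable (a n) μ) (hb : AEStronglyMeasurable b μ)
    (hbtop : eLpNorm b 2 μ ≠ ⊤)
    (h : Tendsto (fun n => eLpNorm (a n - b) 2 μ) atTop (𝓝 0)) :
    Tendsto (fun n => eLpNorm (a n) 2 μ) atTop (𝓝 (eLpNorm b 2 μ)) := by
  rw [ENNReal.tendsto_nhds hbtop]
  intro ε hε
  filter_upwards [ENNReal.tendsto_nhds_zero.1 h ε hε] with n hn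
  exact ⟨tsub_le_iff_right.2 ((eLpNorm_le_add_eLpNorm_sub (ha n) hb).trans (add_le_add le_rfl hn)),
    (eLpNorm_le_add_eLpNorm_sub' (ha n) hb).trans (add_le_add le_rfl hn)⟩

variable {N : ℕ}

/-- **The AT clause is closed under `L²` limits of the amplitude.** On a finite measure space, if
the division-free approximate-tensorisation clause holds with constant `C` for every amplitude `Θₙ`
of a sequence of measurable functions converging in `L²(μ)` to a measurable `Φ` with
`0 < ∫⁻ ‖Φ‖₊² < ⊤`, then it holds for `Φ` with the same constant. In the crux
`ParticleTensorisation` the witness is demanded at every absolute slack `δ > 0` after `N`; at fixed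
`N, L` near-minimisers converge in `L²` (up to phase) to the Dirichlet ground state whenever it is
unique, so the ground state itself inherits the clause — the existential typing does not weaken the
crux below an `N`-uniform heat-bath Poincaré inequality for `|Ψ₀|²`. [folklore] -/
theorem clause_of_tendsto (μ : Measure (Fin N → Space)) [IsFiniteMeasure μ]
    {Θ : ℕ → (Fin N → Space) → ℂ} {Φ : (Fin N → Space) → ℂ} {C : ℝ}
    (hΘ : ∀ n, Measurable (Θ n)) (hΦ : Measurable Φ)
    (hΦ0 : (∫⁻ X, (‖Φ X‖₊ : ℝ≥0∞) ^ 2 ∂μ) ≠ 0) (hΦtop : (∫⁻ X, (‖Φ X‖₊ : ℝ≥0∞) ^ 2 ∂μ) ≠ ⊤)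
    (hlim : Tendsto (fun n => ∫⁻ X, (‖Θ n X - Φ X‖₊ : ℝ≥0∞) ^ 2 ∂μ) atTop (𝓝 0))
    (hAT : ∀ n, ∀ (F : (Fin N → Space) → ℂ) (g : Fin N → (Fin N → Space) → ℂ), Measurable F →
      (∀ i, Measurable (g i)) → (∃ M : ℝ, ∀ X, ‖F X‖ ≤ M ∧ ∀ i, ‖g i X‖ ≤ M) →
      (∀ i X x, g i (Function.update X i x) = g i X) →
      ∃ c : ℂ, (∫⁻ X, (‖F X - c * Θ n X‖₊ : ℝ≥0∞) ^ 2 ∂μ) ≤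
        ENNReal.ofReal C * ∑ i : Fin N, ∫⁻ X, (‖F X - g i X * Θ n X‖₊ : ℝ≥0∞) ^ 2 ∂μ) :
    ∀ (F : (Fin N → Space) → ℂ) (g : Fin N → (Fin N → Space) → ℂ), Measurable F →
      (∀ i, Measurable (g i)) → (∃ M : ℝ, ∀ X, ‖F X‖ ≤ M ∧ ∀ i, ‖g i X‖ ≤ M) →
      (∀ i X x, g i (Function.update X i x) = g i X) →
      ∃ c : ℂ, (∫⁻ X, (‖F X - c * Φ X‖₊ : ℝ≥0∞) ^ 2 ∂μ) ≤
        ENNReal.ofReal C * ∑ i : Fin N, ∫⁻ X, (‖F X - g i X * Φ X‖₊ : ℝ≥0∞) ^ 2 ∂μ := by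
  intro F g hF hg hFg hupd
  obtain ⟨M, hM⟩ := hFg
  have hΘae : ∀ n, AEStronglyMeasurable (Θ n) μ := fun n => (hΘ n).aestronglyMeasurable
  have hΦae : AEStronglyMeasurable Φ μ := hΦ.aestronglyMeasurable
  have hFae : AEStronglyMeasurable F μ := hF.aestronglyMeasurable
  have hgae : ∀ i, AEStronglyMeasurable (g i) μ := fun i => (hg i).aestronglyMeasurable
  -- `‖Θₙ - Φ‖₂ → 0`, `0 < ‖Φ‖₂ < ⊤`
  have hS0 : Tendsto (fun n => eLpNorm (Θ n - Φ) 2 μ) atTop (𝓝 0) :=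
    tendsto_eLpNorm_two_of_tendsto_lintegral (by simpa only [Pi.sub_apply] using hlim)
  have hΦS : eLpNorm Φ 2 μ ≠ ⊤ := by
    intro htop; apply hΦtop; rw [← eLpNorm_two_pow_two, htop, ENNReal.top_pow two_ne_zero]
  have hΦSpos : eLpNorm Φ 2 μ ≠ 0 := by
    intro h0; apply hΦ0; rw [← eLpNorm_two_pow_two, h0]; simp
  -- `L²` norms of bounded functions are finite
  have hbdd : ∀ {u : (Fin N → Space) → ℂ} {K : ℝ}, (∀ X, ‖u X‖ ≤ K) → eLpNorm u 2 μ ≠ ⊤ := by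
    intro u K hu
    refine ne_top_of_le_ne_top ?_ (eLpNorm_le_of_ae_bound (Eventually.of_forall hu))
    exact ENNReal.mul_ne_top (ENNReal.rpow_ne_top_of_nonneg (by positivity) (measure_ne_top _ _))
      ENNReal.ofReal_ne_top
  have hFS : eLpNorm F 2 μ ≠ ⊤ := hbdd fun X => (hM X).1
  -- `‖F - u Φ‖₂ < ⊤` for a bounded multiplier `u`
  have hFuΦ : ∀ {u : (Fin N → Space) → ℂ} {K : ℝ}, (∀ X, ‖u X‖ ≤ K) → AEStronglyMeasurable u μ →
      eLpNorm (fun X => F X - u X * Φ X) 2 μ ≠ ⊤ := by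
    intro u K hu huae
    have hle : eLpNorm (fun X => F X - u X * Φ X) 2 μ ≤
        eLpNorm F 2 μ + ENNReal.ofReal K * eLpNorm Φ 2 μ :=
      calc eLpNorm (fun X => F X - u X * Φ X) 2 μ
          ≤ eLpNorm F 2 μ + eLpNorm (fun X => u X * Φ X) 2 μ :=
            eLpNorm_sub_le hFae (huae.mul hΦae) (by norm_num)
        _ ≤ eLpNorm F 2 μ + ENNReal.ofReal K * eLpNorm Φ 2 μ :=
            add_le_add le_rfl (eLpNorm_mul_le_of_bound hu)
    exact ne_top_of_le_ne_top (ENNReal.add_ne_top.2 ⟨hFS, ENNReal.mul_ne_top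
      ENNReal.ofReal_ne_top hΦS⟩) hle
  -- the coefficients
  choose c hc using fun n => hAT n F g hF hg ⟨M, hM⟩ hupd
  -- right-hand sides converge: `Rₙ := C Σᵢ ∫⁻ ‖F - gᵢΘₙ‖² → R := C Σᵢ ∫⁻ ‖F - gᵢΦ‖²`
  have hRi : ∀ i, Tendsto (fun n => eLpNorm (fun X => F X - g i X * Θ n X) 2 μ) atTop
      (𝓝 (eLpNorm (fun X => F X - g i X * Φ X) 2 μ)) := by
    intro i
    refine tendsto_eLpNorm_of_tendsto_sub (fun n => hFae.sub ((hgae i).mul (hΘae n)))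
      (hFae.sub ((hgae i).mul hΦae)) (hFuΦ (fun X => (hM X).2 i) (hgae i)) ?_
    have heq : ∀ n, ((fun X => F X - g i X * Θ n X) - fun X => F X - g i X * Φ X) =
        fun X => -g i X * (Θ n - Φ) X := fun n => by ext X; simp; ring
    simp_rw [heq]
    refine tendsto_of_tendsto_of_tendsto_of_le_of_le tendsto_const_nhds ?_ (fun _ => bot_le)
      (fun n => eLpNorm_mul_le_of_bound (M := M) fun X => by rw [norm_neg]; exact (hM X).2 i)
    simpa using ENNReal.Tendsto.const_mul hS0 (Or.inr ENNReal.ofReal_ne_top)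
  set R : ℝ≥0∞ := ENNReal.ofReal C * ∑ i : Fin N, ∫⁻ X, (‖F X - g i X * Φ X‖₊ : ℝ≥0∞) ^ 2 ∂μ
    with hRdef
  have hR : Tendsto (fun n => ENNReal.ofReal C * ∑ i : Fin N,
      ∫⁻ X, (‖F X - g i X * Θ n X‖₊ : ℝ≥0∞) ^ 2 ∂μ) atTop (𝓝 R) := by
    refine ENNReal.Tendsto.const_mul (tendsto_finsetSum _ fun i _ => ?_) (Or.inr ENNReal.ofReal_ne_top)
    have := (ENNReal.continuous_pow 2).tendsto _ |>.comp (hRi i)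
    simpa only [Function.comp_def, eLpNorm_two_pow_two] using this
  have hRtop : R ≠ ⊤ := by
    refine ENNReal.mul_ne_top ENNReal.ofReal_ne_top (ENNReal.sum_ne_top.2 fun i _ => ?_)
    rw [← eLpNorm_two_pow_two]
    exact ENNReal.pow_ne_top (hFuΦ (fun X => (hM X).2 i) (hgae i))
  -- eventually `Rₙ ≤ R + 1` and `‖Θₙ - Φ‖₂ ≤ ‖Φ‖₂ / 2`
  have hev1 : ∀ᶠ n in atTop, ENNReal.ofReal C * ∑ i : Fin N,
      ∫⁻ X, (‖F X - g i X * Θ n X‖₊ : ℝ≥0∞) ^ 2 ∂μ ≤ R + 1 :=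
    ((ENNReal.tendsto_nhds hRtop).1 hR 1 one_pos).mono fun n hn => hn.2
  have hev2 : ∀ᶠ n in atTop, eLpNorm (Θ n - Φ) 2 μ ≤ eLpNorm Φ 2 μ / 2 :=
    ENNReal.tendsto_nhds_zero.1 hS0 _ (ENNReal.half_pos hΦSpos)
  -- hence eventually `‖Φ‖₂ / 2 ≤ ‖Θₙ‖₂`
  have hΘlow : ∀ n, eLpNorm (Θ n - Φ) 2 μ ≤ eLpNorm Φ 2 μ / 2 →
      eLpNorm Φ 2 μ / 2 ≤ eLpNorm (Θ n) 2 μ := by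
    intro n hn
    have h1 : eLpNorm Φ 2 μ ≤ eLpNorm (Θ n) 2 μ + eLpNorm Φ 2 μ / 2 :=
      (eLpNorm_le_add_eLpNorm_sub (hΘae n) hΦae).trans (add_le_add le_rfl hn)
    calc eLpNorm Φ 2 μ / 2 = eLpNorm Φ 2 μ - eLpNorm Φ 2 μ / 2 := (ENNReal.sub_half hΦS).symm
      _ ≤ eLpNorm (Θ n) 2 μ := tsub_le_iff_right.2 h1
  -- and eventually `‖cₙ‖ ≤ K`
  set A : ℝ≥0∞ := eLpNorm F 2 μ + (R + 1) ^ (1 / 2 : ℝ) with hAdef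
  have hAtop : A ≠ ⊤ := ENNReal.add_ne_top.2 ⟨hFS, ENNReal.rpow_ne_top_of_nonneg (by norm_num)
    (ENNReal.add_ne_top.2 ⟨hRtop, ENNReal.one_ne_top⟩)⟩
  set K : ℝ := (A / (eLpNorm Φ 2 μ / 2)).toReal with hKdef
  have hKtop : A / (eLpNorm Φ 2 μ / 2) ≠ ⊤ :=
    ENNReal.div_ne_top hAtop (ENNReal.half_pos hΦSpos).ne'
  have hcK : ∀ n, ENNReal.ofReal C * ∑ i : Fin N,
      ∫⁻ X, (‖F X - g i X * Θ n X‖₊ : ℝ≥0∞) ^ 2 ∂μ ≤ R + 1 →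
      eLpNorm (Θ n - Φ) 2 μ ≤ eLpNorm Φ 2 μ / 2 → ‖c n‖ ≤ K := by
    intro n h1 h2
    -- `‖cₙ‖ₑ ‖Θₙ‖₂ = ‖cₙΘₙ‖₂ ≤ ‖F‖₂ + ‖F - cₙΘₙ‖₂ ≤ A`
    have hsm : eLpNorm (fun X => c n * Θ n X) 2 μ = ‖c n‖ₑ * eLpNorm (Θ n) 2 μ := by
      rw [← eLpNorm_const_smul]; rfl
    have hle : eLpNorm (fun X => F X - c n * Θ n X) 2 μ ≤ (R + 1) ^ (1 / 2 : ℝ) := by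
      rw [eLpNorm_two_eq_rpow]
      exact ENNReal.rpow_le_rpow ((hc n).trans h1) (by norm_num)
    have hA : ‖c n‖ₑ * eLpNorm (Θ n) 2 μ ≤ A := by
      rw [← hsm]
      have hwae : AEStronglyMeasurable (fun X => c n * Θ n X) μ :=
        (measurable_const.mul (hΘ n)).aestronglyMeasurable
      have h3 : eLpNorm (F - fun X => c n * Θ n X) 2 μ ≤ (R + 1) ^ (1 / 2 : ℝ) := by
        have heq2 : (F - fun X => c n * Θ n X) = fun X => F X - c n * Θ n X := by ext X; simp
        rw [heq2]; exact hle
      exact (eLpNorm_le_add_eLpNorm_sub hFae hwae).trans (add_le_add le_rfl h3)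
    have hB : ‖c n‖ₑ * (eLpNorm Φ 2 μ / 2) ≤ A :=
      (mul_le_mul' le_rfl (hΘlow n h2)).trans hA
    have hdiv : ‖c n‖ₑ ≤ A / (eLpNorm Φ 2 μ / 2) := by
      rw [ENNReal.le_div_iff_mul_le (Or.inl (ENNReal.half_pos hΦSpos).ne')
        (Or.inl (ENNReal.div_ne_top hΦS two_ne_zero))]
      exact hB
    rw [hKdef, ← ENNReal.ofReal_le_iff_le_toReal hKtop, ofReal_norm]
    exact hdiv
  obtain ⟨N₀, hN₀⟩ := eventually_atTop.1 (hev1.and hev2)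
  -- Bolzano–Weierstrass on the shifted coefficient sequence
  obtain ⟨a, -, φ, hφ, hφlim⟩ := tendsto_subseq_of_bounded (Metric.isBounded_closedBall (x := (0 : ℂ))
    (r := K)) (x := fun k => c (k + N₀)) (fun k => by
      rw [Metric.mem_closedBall, dist_zero_right]
      exact hcK _ (hN₀ _ (Nat.le_add_left _ _)).1 (hN₀ _ (Nat.le_add_left _ _)).2)
  set m : ℕ → ℕ := fun k => φ k + N₀ with hmdef
  have hm : Tendsto m atTop atTop :=
    StrictMono.tendsto_atTop fun i j hij => Nat.add_lt_add_right (hφ hij) _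
  have hcm : Tendsto (fun k => c (m k)) atTop (𝓝 a) := hφlim
  refine ⟨a, ?_⟩
  -- the left-hand sides converge along `m`: `∫⁻ ‖F - c_{m k} Θ_{m k}‖² → ∫⁻ ‖F - aΦ‖²`
  have hL : Tendsto (fun k => eLpNorm (fun X => F X - c (m k) * Θ (m k) X) 2 μ) atTop
      (𝓝 (eLpNorm (fun X => F X - a * Φ X) 2 μ)) := by
    refine tendsto_eLpNorm_of_tendsto_sub
      (fun k => hFae.sub ((measurable_const.mul (hΘ _)).aestronglyMeasurable))
      (hFae.sub ((measurable_const.mul hΦ).aestronglyMeasurable))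
      (hFuΦ (u := fun _ => a) (fun X => le_rfl) measurable_const.aestronglyMeasurable) ?_
    -- `‖(F - c_m Θ_m) - (F - aΦ)‖₂ ≤ ‖c_m - a‖ₑ ‖Θ_m‖₂ + ‖a‖ₑ ‖Θ_m - Φ‖₂ → 0`
    have hbound : ∀ k, eLpNorm ((fun X => F X - c (m k) * Θ (m k) X) - fun X => F X - a * Φ X) 2 μ
        ≤ ‖c (m k) - a‖ₑ * (eLpNorm Φ 2 μ + eLpNorm (Θ (m k) - Φ) 2 μ)
          + ‖a‖ₑ * eLpNorm (Θ (m k) - Φ) 2 μ := by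
      intro k
      have heq : ((fun X => F X - c (m k) * Θ (m k) X) - fun X => F X - a * Φ X) =
          (fun X => (a - c (m k)) * Θ (m k) X) + fun X => a * (Φ - Θ (m k)) X := by
        ext X; simp; ring
      rw [heq]
      have hae1 : AEStronglyMeasurable (fun X => (a - c (m k)) * Θ (m k) X) μ :=
        (measurable_const.mul (hΘ _)).aestronglyMeasurable
      have hae2 : AEStronglyMeasurable (fun X => a * (Φ - Θ (m k)) X) μ :=
        (measurable_const.mul (hΦ.sub (hΘ _))).aestronglyMeasurable
      have hA1 : eLpNorm (fun X => (a - c (m k)) * Θ (m k) X) 2 μ ≤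
          ‖c (m k) - a‖ₑ * (eLpNorm Φ 2 μ + eLpNorm (Θ (m k) - Φ) 2 μ) := by
        have h1 : eLpNorm (fun X => (a - c (m k)) * Θ (m k) X) 2 μ =
            ‖a - c (m k)‖ₑ * eLpNorm (Θ (m k)) 2 μ := by rw [← eLpNorm_const_smul]; rfl
        rw [h1, ← enorm_neg, neg_sub]
        exact mul_le_mul' le_rfl (eLpNorm_le_add_eLpNorm_sub' (hΘae _) hΦae)
      have hA2 : eLpNorm (fun X => a * (Φ - Θ (m k)) X) 2 μ ≤ ‖a‖ₑ * eLpNorm (Θ (m k) - Φ) 2 μ := by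
        have h2 : eLpNorm (fun X => a * (Φ - Θ (m k)) X) 2 μ =
            ‖a‖ₑ * eLpNorm (Φ - Θ (m k)) 2 μ := by rw [← eLpNorm_const_smul]; rfl
        rw [h2, eLpNorm_sub_comm]
      exact (eLpNorm_add_le hae1 hae2 (by norm_num)).trans (add_le_add hA1 hA2)
    refine tendsto_of_tendsto_of_tendsto_of_le_of_le tendsto_const_nhds ?_ (fun _ => bot_le) hbound
    have hS0m : Tendsto (fun k => eLpNorm (Θ (m k) - Φ) 2 μ) atTop (𝓝 0) := hS0.comp hm
    have hca : Tendsto (fun k => (‖c (m k) - a‖ₑ : ℝ≥0∞)) atTop (𝓝 0) := by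
      have h1 : Tendsto (fun k => ‖c (m k) - a‖) atTop (𝓝 0) :=
        tendsto_iff_norm_sub_tendsto_zero.1 hcm
      have h2 := ENNReal.tendsto_ofReal h1
      rw [ENNReal.ofReal_zero] at h2
      simpa only [ofReal_norm] using h2
    have hsum : Tendsto (fun k => eLpNorm Φ 2 μ + eLpNorm (Θ (m k) - Φ) 2 μ) atTop
        (𝓝 (eLpNorm Φ 2 μ)) := by
      simpa using tendsto_const_nhds.add hS0m
    have hprod := ENNReal.Tendsto.mul hca (Or.inr hΦS) hsum (Or.inr ENNReal.zero_ne_top)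
    have hsec := ENNReal.Tendsto.const_mul hS0m (Or.inr (enorm_ne_top (E := ℂ) (x := a)))
    simpa using hprod.add hsec
  have hL2 : Tendsto (fun k => ∫⁻ X, (‖F X - c (m k) * Θ (m k) X‖₊ : ℝ≥0∞) ^ 2 ∂μ) atTop
      (𝓝 (∫⁻ X, (‖F X - a * Φ X‖₊ : ℝ≥0∞) ^ 2 ∂μ)) := by
    have := (ENNReal.continuous_pow 2).tendsto _ |>.comp hL
    simpa only [Function.comp_def, eLpNorm_two_pow_two] using this
  exact le_of_tendsto_of_tendsto' hL2 (hR.comp hm) fun k => hc (m k)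

end Summit.AtomisticToContinuum.BoseEinsteinCondensation.Theorems.ATClause
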